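import Literature.NumberTheory.GaloisRepresentations.HasseNormEtaleInvolution
import Literature.NumberTheory.GaloisRepresentations.QuadraticArtinIndicator
import Literature.NumberTheory.AdelicBaseChange.AdeleNormGalois
import HarnessLib

/-!
# The quadratic Artin indicator of `C / C^τ`: for an involution `τ ≠ 1` of a number field `C` with fixed field `K = C^τ`,
# `C = K(√d)` for any `δ` with `τ δ = −δ ≠ 0`, `d = δ²`, and `Kˣ · N_{C/K}(𝕀_C) = Kˣ · normIdeles K d`

Topic `NumberTheory/GaloisRepresentations` (global class field theory, quadratic case); namespace
`Literature.NumberTheory.GaloisRepresentations`.  THEOREMS ONLY (no definition, no named fact, no instance, no notation, no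
`sorry`); net debt 0.

THE PRINT.  Artin: for a finite group `G` of automorphisms of a field `C`, `[C : C^G] = |G|` and `C/C^G` is Galois with group `G`
([Lang2002, Ch. VI §1 Thm. 1.8]); for `G = ⟨τ⟩` of order `2` this is `[C : C^τ] = 2`, and any `δ ≠ 0` with `τ δ = −δ` generates,
`C = C^τ(δ)`, `δ² ∈ C^τ` (Kummer theory in degree `2`, [Lang2002, Ch. VI §6 Thm. 6.2]).  O'Meara [Omeara1963, §65A Example 65:2]:
for the quadratic extension `E = K(√d)` the idelic norm group `N_{E/K} J_E` is the group of idèles of `K` that are local norms at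
every place — the tree's componentwise ★ `QuadraticForms.normIdeles K d` (★ `Automorphic.range_ideleRelNorm_eq_normIdeles`); hence the
norm group `Kˣ · N_{E/K}(J_E)` of class field theory ([CasselsFrohlichANT1967, Ch. VII §5.1 (B)]) is `Kˣ · normIdeles K d`, the group on
which the quadratic Artin indicator ★ `quadraticArtinIndicator K d` vanishes.

WHAT IS PROVED (letters of ★ `HasseNormEtaleInvolution` §1 ∕ ★ `HasseNormEtaleInvolutionDescent`: `τ : C ≃ₐ[F] C`, `hτ : τ * τ = 1`,
`hτ1 : τ ≠ 1`, `K := ↥(IntermediateField.fixedField (Subgroup.zpowers τ))`, binder `[IsGalois K C]` (:= ★ `isGalois_fixedField_zpowers`),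
`N_{C/K}` := the Galois-descent norm ★ `Automorphic.AdeleRing.ideleRelNorm K C`, `(k)` := ★ `IdeleHerbrand.principal K k`, and `δ : C` with
`hδ : τ δ = -δ`, `hδ0 : δ ≠ 0`, `hd : δ * δ = algebraMap K C d`).
* §1 (J1) **`isQuadraticExtension_fixedField_zpowers`** (`Algebra.IsQuadraticExtension K C`), `mul_self_mem_fixedField_of_apply_eq_neg`
  (`δ · δ ∈ K`), `subgroupEquivAlgEquiv_zpowers_apply_eq_neg` (the Galois generator of `C/K` moves `δ` to `−δ`),
  `algebraMap_fixedField_algebraMap` (`F → K → C = F → C`), `exists_ne_zero_apply_eq_neg`.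
* §2 (J2) **`range_ideleRelNorm_fixedField_eq_normIdeles`**: `N_{C/K}(𝕀_C) = normIdeles K d`; the same for the FLT-packet norm
  ★ `AdelicBaseChange.ideleRelNorm` (the two tree norms agree, ★ `automorphic_ideleRelNorm_eq`);
  (J3) **`principalIdeles_sup_range_ideleRelNorm_fixedField_eq`**: `Kˣ · N_{C/K}(𝕀_C) = Kˣ · normIdeles K d`.
* §3 (J4) **`quadraticArtinIndicator_fixedField_eq_zero_iff`**: `[X]_{K,d} = 0 ↔ X = (k) · N_{C/K} Z` for a global `k ∈ Kˣ` and an idèle `Z`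
  of `C`; `…_eq_zero_iff_mem_sup`; `quadraticArtinIndicator_fixedField_ideleRelNorm` (`[N_{C/K} Z]_{K,d} = 0`);
  `quadraticArtinIndicator_fixedField_principal_mul_ideleRelNorm` (`[(k) · N_{C/K} Z] = 0`); `quadraticArtinIndicator_fixedField_mul_ideleRelNorm`
  (`[X · N_{C/K} Z] = [X]`).
* §4 (J5) the same with the parameter `d ∈ F` of the BASE (`δ² = d ⊗ 1`, indicator at `algebraMap F K d`) — the shape in which the
  consumer meets it: `C = K₀,𝔪 · L` with `L = F(√d)`, `δ = θ̄`.

USE (cell hodgecm-mathlib, engine T1, row G6 «pre-stabilisation for the `U(3)` tori», crux H413 = `stmt-HodgeConjecture-24833`): the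
JUNCTION between ★ `HasseNormEtaleInvolution{,Factors,Descent}` (per τ-stable factor `𝔪` of the Cartan algebra `L[γ₀]`, the residue
field `C = K_𝔪` with `τ = cartanResidueInvolution 𝔪 ≠ 1`, ★ `CartanIndex`, and the descended idèle `W_𝔪 ∈ 𝕀_{K₀,𝔪}`, `K₀,𝔪 = C^τ`, with
`con(N_{C/K} Z) = Z · τZ`, `con((k) · N Z) = (k)_C · Z · τZ` — (E2)∕(E5) there) and ★ `QuadraticArtinIndicator` (`cartanObs_𝔪 = [W_𝔪]_{K₀,𝔪, d}`):
`CartanObstruction` ∕ `CartanObsHasse` ([Rogawski1990, §3.3 Prop. 3.3.1, §3.5 Prop. 3.5.2]) read «`[W_𝔪] = 0` ⇔ `W_𝔪 = (k) · N_{C/K} Z`»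
through (J4), with the quadratic-extension instance, the generator and the parameter supplied HERE once rather than inline at each use.
HC_CM is proved only modulo the printed citations until rung 0 closes; this file is Galois∕idelic number theory of a quadratic extension
presented by an involution and asserts nothing about unitary groups.

## References
* [Lang2002] S. Lang, *Algebra*, 3rd ed. (2002), Ch. VI §1 Thm. 1.8 (Artin), §6 Thm. 6.2 (Kummer, cyclic of degree `n`).
* [Omeara1963] O. T. O'Meara, *Introduction to Quadratic Forms* (1963), §65A Example 65:2.
* [CasselsFrohlichANT1967] Cassels–Fröhlich (eds.), *Algebraic Number Theory* (1967), Ch. VII (Tate) §5.1 (B), §7.3.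
* [Rogawski1990] J. D. Rogawski, *Automorphic Representations of Unitary Groups in Three Variables* (1990), §3.3, §3.5 Prop. 3.5.2.
-/

set_option autoImplicit false

noncomputable section

open NumberField IsDedekindDomain
open scoped Classical

namespace Literature.NumberTheory.GaloisRepresentations

open Literature.NumberTheory.QuadraticForms

/-! ## §1 `C / C^τ` is a quadratic extension generated by any anti-fixed `δ` -/

section Quadratic

variable {F C : Type} [Field F] [Field C] [Algebra F C] (τ : C ≃ₐ[F] C)

/-- **(J1) `C / C^τ` is a quadratic extension** (`[C : C^τ] = 2`, ★ `finrank_fixedField_zpowers_eq_two`; a vector space over a field is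
free), as Mathlib's class `Algebra.IsQuadraticExtension` consumed by ★ `Automorphic.range_ideleRelNorm_eq_normIdeles` ∕ ★
`quadraticArtinIndicator_eq_zero_iff_exists_ideleRelNorm`. [cite: Lang2002, Ch. VI §1 Thm. 1.8 (Artin)] -/
theorem isQuadraticExtension_fixedField_zpowers [FiniteDimensional F C] (hτ : τ * τ = 1) (hτ1 : τ ≠ 1) :
    Algebra.IsQuadraticExtension (IntermediateField.fixedField (Subgroup.zpowers τ)) C :=
  { finrank_eq_two' := finrank_fixedField_zpowers_eq_two τ hτ hτ1 }

/-- `δ · δ ∈ C^τ` whenever `τ δ = −δ` (`τ(δ²) = (−δ)² = δ²`). [cite: Lang2002, Ch. VI §6 Thm. 6.2] -/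
theorem mul_self_mem_fixedField_of_apply_eq_neg {δ : C} (hδ : τ δ = -δ) :
    δ * δ ∈ IntermediateField.fixedField (Subgroup.zpowers τ) :=
  mem_fixedField_of_apply_eq τ (by rw [map_mul, hδ, neg_mul_neg])

/-- The element `d := δ²` of the fixed field maps to `δ · δ` in `C`. [cite: Lang2002, Ch. VI §6 Thm. 6.2] -/
theorem algebraMap_mul_self_fixedField {δ : C} (hδ : τ δ = -δ) :
    algebraMap (IntermediateField.fixedField (Subgroup.zpowers τ)) C ⟨δ * δ, mul_self_mem_fixedField_of_apply_eq_neg τ hδ⟩ = δ * δ :=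
  rfl

/-- The Galois generator of `C / C^τ` defined by `τ` (Mathlib `subgroupEquivAlgEquiv`) moves `δ` to `−δ`. [cite: Lang2002, Ch. VI §1 Thm. 1.8 (Artin)] -/
theorem subgroupEquivAlgEquiv_zpowers_apply_eq_neg [FiniteDimensional F C] {δ : C} (hδ : τ δ = -δ) :
    IntermediateField.subgroupEquivAlgEquiv (Subgroup.zpowers τ) ⟨τ, Subgroup.mem_zpowers τ⟩ δ = -δ := by
  rw [subgroupEquivAlgEquiv_zpowers_apply, hδ]

/-- `F → C^τ → C` is `F → C` (the intermediate field's scalar tower). [cite: Lang2002, Ch. VI §1 Thm. 1.8 (Artin)] -/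
theorem algebraMap_fixedField_algebraMap (d : F) :
    algebraMap (IntermediateField.fixedField (Subgroup.zpowers τ)) C
        (algebraMap F (IntermediateField.fixedField (Subgroup.zpowers τ)) d) = algebraMap F C d :=
  (IsScalarTower.algebraMap_apply F (IntermediateField.fixedField (Subgroup.zpowers τ)) C d).symm

/-- `δ² = d ⊗ 1` with `d ∈ F` is `δ² = (algebraMap F (C^τ) d)` seen in `C`. [cite: Lang2002, Ch. VI §6 Thm. 6.2] -/
theorem mul_self_eq_algebraMap_fixedField {δ : C} {d : F} (hd : δ * δ = algebraMap F C d) :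
    δ * δ = algebraMap (IntermediateField.fixedField (Subgroup.zpowers τ)) C
      (algebraMap F (IntermediateField.fixedField (Subgroup.zpowers τ)) d) := by
  rw [algebraMap_fixedField_algebraMap, hd]

/-- A non-trivial `F`-involution of `C` has an anti-fixed non-zero element `δ = c − τ c`. [cite: Lang2002, Ch. VI §6 Thm. 6.2] -/
theorem exists_ne_zero_apply_eq_neg (hτ : τ * τ = 1) (hτ1 : τ ≠ 1) : ∃ δ : C, δ ≠ 0 ∧ τ δ = -δ := by
  have hex : ∃ c : C, τ c ≠ c := by
    by_contra h
    exact hτ1 (AlgEquiv.ext fun c => not_not.mp (not_exists.mp h c))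
  obtain ⟨c, hc⟩ := hex
  refine ⟨c - τ c, sub_ne_zero.2 (Ne.symm hc), ?_⟩
  rw [map_sub, show τ (τ c) = (τ * τ) c from rfl, hτ, AlgEquiv.one_apply, neg_sub]

/-- If `δ ≠ 0` and `δ² = d ⊗ 1` then `d ≠ 0`. [cite: Lang2002, Ch. VI §6 Thm. 6.2] -/
theorem ne_zero_of_mul_self_eq_algebraMap {K : Type} [Field K] [Algebra K C] {δ : C} (hδ0 : δ ≠ 0) {d : K}
    (hd : δ * δ = algebraMap K C d) : d ≠ 0 := by
  intro h
  rw [h, map_zero, mul_self_eq_zero] at hd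
  exact hδ0 hd

end Quadratic

/-! ## §2 The idelic norm group of `C / C^τ` is `normIdeles (C^τ) (δ²)` -/

section NormIdeles

open Literature.NumberTheory.Automorphic

variable {F C : Type} [Field F] [NumberField F] [Field C] [NumberField C] [Algebra F C] (τ : C ≃ₐ[F] C)

/-- **(J2) O'Meara 65:2 for `C / C^τ`**: `N_{C/C^τ}(𝕀_C) = normIdeles (C^τ) d` for `τ δ = −δ ≠ 0`, `δ² = d` — `N_{C/C^τ}` the Galois-descent
norm ★ `Automorphic.AdeleRing.ideleRelNorm` (binder `[IsGalois C^τ C]` := ★ `isGalois_fixedField_zpowers`); ★ `range_ideleRelNorm_eq_normIdeles`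
at the Galois generator defined by `τ`. [cite: Omeara1963, §65A Example 65:2] -/
theorem range_ideleRelNorm_fixedField_eq_normIdeles [IsGalois (IntermediateField.fixedField (Subgroup.zpowers τ)) C]
    (hτ : τ * τ = 1) (hτ1 : τ ≠ 1) {δ : C} (hδ : τ δ = -δ) (hδ0 : δ ≠ 0) {d : IntermediateField.fixedField (Subgroup.zpowers τ)}
    (hd : δ * δ = algebraMap (IntermediateField.fixedField (Subgroup.zpowers τ)) C d) :
    (AdeleRing.ideleRelNorm (↥(IntermediateField.fixedField (Subgroup.zpowers τ))) C).range =
      normIdeles (↥(IntermediateField.fixedField (Subgroup.zpowers τ))) d := by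
  haveI := isQuadraticExtension_fixedField_zpowers τ hτ hτ1
  exact range_ideleRelNorm_eq_normIdeles (IntermediateField.subgroupEquivAlgEquiv (Subgroup.zpowers τ) ⟨τ, Subgroup.mem_zpowers τ⟩)
    (subgroupEquivAlgEquiv_zpowers_apply_eq_neg τ hδ) hδ0 hd

/-- (J2) for the FLT-packet norm ★ `AdelicBaseChange.ideleRelNorm` (no Galois binder in the statement; the two tree norms agree,
★ `automorphic_ideleRelNorm_eq`). [cite: Omeara1963, §65A Example 65:2] [cite: CasselsFrohlichANT1967, Ch. VII §7.3] -/
theorem range_adelicBaseChangeIdeleRelNorm_fixedField_eq_normIdeles (hτ : τ * τ = 1) (hτ1 : τ ≠ 1) {δ : C} (hδ : τ δ = -δ) (hδ0 : δ ≠ 0)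
    {d : IntermediateField.fixedField (Subgroup.zpowers τ)} (hd : δ * δ = algebraMap (IntermediateField.fixedField (Subgroup.zpowers τ)) C d) :
    (Literature.NumberTheory.AdelicBaseChange.ideleRelNorm (↥(IntermediateField.fixedField (Subgroup.zpowers τ))) C).toMonoidHom.range =
      normIdeles (↥(IntermediateField.fixedField (Subgroup.zpowers τ))) d := by
  haveI := isGalois_fixedField_zpowers τ
  rw [← Literature.NumberTheory.AdelicBaseChange.automorphic_ideleRelNorm_eq_toMonoidHom]
  exact range_ideleRelNorm_fixedField_eq_normIdeles τ hτ hτ1 hδ hδ0 hd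

/-- Membership form of (J2): `X ∈ normIdeles (C^τ) d ↔ ∃ Z, N_{C/C^τ} Z = X`. [cite: Omeara1963, §65A Example 65:2] -/
theorem mem_normIdeles_fixedField_iff_exists_ideleRelNorm_eq [IsGalois (IntermediateField.fixedField (Subgroup.zpowers τ)) C]
    (hτ : τ * τ = 1) (hτ1 : τ ≠ 1) {δ : C} (hδ : τ δ = -δ) (hδ0 : δ ≠ 0) {d : IntermediateField.fixedField (Subgroup.zpowers τ)}
    (hd : δ * δ = algebraMap (IntermediateField.fixedField (Subgroup.zpowers τ)) C d)
    (X : ideleGroup (↥(IntermediateField.fixedField (Subgroup.zpowers τ)))) :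
    X ∈ normIdeles (↥(IntermediateField.fixedField (Subgroup.zpowers τ))) d ↔
      ∃ Z : ideleGroup C, AdeleRing.ideleRelNorm (↥(IntermediateField.fixedField (Subgroup.zpowers τ))) C Z = X := by
  rw [← range_ideleRelNorm_fixedField_eq_normIdeles τ hτ hτ1 hδ hδ0 hd, MonoidHom.mem_range]

/-- **(J3) The norm group**: `(C^τ)ˣ · N_{C/C^τ}(𝕀_C) = (C^τ)ˣ · normIdeles (C^τ) d` as subgroups of `𝕀_{C^τ}` — the group on which the
quadratic Artin indicator `[·]_{C^τ, d}` vanishes. [cite: CasselsFrohlichANT1967, Ch. VII §5.1 (B)] [cite: Omeara1963, §65A Example 65:2] -/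
theorem principalIdeles_sup_range_ideleRelNorm_fixedField_eq [IsGalois (IntermediateField.fixedField (Subgroup.zpowers τ)) C]
    (hτ : τ * τ = 1) (hτ1 : τ ≠ 1) {δ : C} (hδ : τ δ = -δ) (hδ0 : δ ≠ 0) {d : IntermediateField.fixedField (Subgroup.zpowers τ)}
    (hd : δ * δ = algebraMap (IntermediateField.fixedField (Subgroup.zpowers τ)) C d) :
    principalIdeles (↥(IntermediateField.fixedField (Subgroup.zpowers τ))) ⊔
        (AdeleRing.ideleRelNorm (↥(IntermediateField.fixedField (Subgroup.zpowers τ))) C).range =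
      principalIdeles (↥(IntermediateField.fixedField (Subgroup.zpowers τ))) ⊔
        normIdeles (↥(IntermediateField.fixedField (Subgroup.zpowers τ))) d := by
  rw [range_ideleRelNorm_fixedField_eq_normIdeles τ hτ hτ1 hδ hδ0 hd]

end NormIdeles

/-! ## §3 The quadratic Artin indicator of `C / C^τ` -/

section Indicator

open Literature.NumberTheory.Automorphic

variable {F C : Type} [Field F] [NumberField F] [Field C] [NumberField C] [Algebra F C] (τ : C ≃ₐ[F] C)

/-- `IdeleHerbrand.principal K k` is the principal idèle `Units.map (algebraMap K 𝔸_K) k` (the spelling of ★ `QuadraticArtinIndicator`). [folklore] -/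
private theorem principal_eq_unitsMap (K : Type) [Field K] [NumberField K] (k : Kˣ) :
    IdeleHerbrand.principal K k = Units.map (algebraMap K (AdeleRing (𝓞 K) K)).toMonoidHom k := rfl

/-- **(J4) `[X]_{C^τ, d} = 0 ⟺ X = (k) · N_{C/C^τ}(Z)`** for a global `k ∈ (C^τ)ˣ` (`(k)` = ★ `IdeleHerbrand.principal`) and an idèle `Z` of `C`
(`τ δ = −δ ≠ 0`, `δ² = d`): ★ `quadraticArtinIndicator_eq_zero_iff_exists_ideleRelNorm` at the Galois generator defined by `τ`.
[cite: Omeara1963, §65A Example 65:2] [cite: CasselsFrohlichANT1967, Ch. VII §5.1 (B)] -/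
theorem quadraticArtinIndicator_fixedField_eq_zero_iff [IsGalois (IntermediateField.fixedField (Subgroup.zpowers τ)) C]
    (hτ : τ * τ = 1) (hτ1 : τ ≠ 1) {δ : C} (hδ : τ δ = -δ) (hδ0 : δ ≠ 0) {d : IntermediateField.fixedField (Subgroup.zpowers τ)}
    (hd : δ * δ = algebraMap (IntermediateField.fixedField (Subgroup.zpowers τ)) C d)
    (X : ideleGroup (↥(IntermediateField.fixedField (Subgroup.zpowers τ)))) :
    quadraticArtinIndicator (↥(IntermediateField.fixedField (Subgroup.zpowers τ))) d X = 0 ↔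
      ∃ (k : (↥(IntermediateField.fixedField (Subgroup.zpowers τ)))ˣ) (Z : ideleGroup C),
        X = IdeleHerbrand.principal (↥(IntermediateField.fixedField (Subgroup.zpowers τ))) k *
          AdeleRing.ideleRelNorm (↥(IntermediateField.fixedField (Subgroup.zpowers τ))) C Z := by
  haveI := isQuadraticExtension_fixedField_zpowers τ hτ hτ1
  exact quadraticArtinIndicator_eq_zero_iff_exists_ideleRelNorm
    (IntermediateField.subgroupEquivAlgEquiv (Subgroup.zpowers τ) ⟨τ, Subgroup.mem_zpowers τ⟩)
    (subgroupEquivAlgEquiv_zpowers_apply_eq_neg τ hδ) hδ0 hd X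

/-- **(J4), subgroup form**: `[X]_{C^τ, d} = 0 ↔ X ∈ (C^τ)ˣ · N_{C/C^τ}(𝕀_C)`. [cite: CasselsFrohlichANT1967, Ch. VII §5.1 (B)] -/
theorem quadraticArtinIndicator_fixedField_eq_zero_iff_mem_sup [IsGalois (IntermediateField.fixedField (Subgroup.zpowers τ)) C]
    (hτ : τ * τ = 1) (hτ1 : τ ≠ 1) {δ : C} (hδ : τ δ = -δ) (hδ0 : δ ≠ 0) {d : IntermediateField.fixedField (Subgroup.zpowers τ)}
    (hd : δ * δ = algebraMap (IntermediateField.fixedField (Subgroup.zpowers τ)) C d)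
    (X : ideleGroup (↥(IntermediateField.fixedField (Subgroup.zpowers τ)))) :
    quadraticArtinIndicator (↥(IntermediateField.fixedField (Subgroup.zpowers τ))) d X = 0 ↔
      X ∈ principalIdeles (↥(IntermediateField.fixedField (Subgroup.zpowers τ))) ⊔
        (AdeleRing.ideleRelNorm (↥(IntermediateField.fixedField (Subgroup.zpowers τ))) C).range := by
  rw [principalIdeles_sup_range_ideleRelNorm_fixedField_eq τ hτ hτ1 hδ hδ0 hd]
  exact quadraticArtinIndicator_eq_zero_iff

/-- **Norms from `C` have indicator `0`**: `[N_{C/C^τ} Z]_{C^τ, d} = 0`. [cite: Omeara1963, §65A Example 65:2] -/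
theorem quadraticArtinIndicator_fixedField_ideleRelNorm [IsGalois (IntermediateField.fixedField (Subgroup.zpowers τ)) C]
    (hτ : τ * τ = 1) (hτ1 : τ ≠ 1) {δ : C} (hδ : τ δ = -δ) (hδ0 : δ ≠ 0) {d : IntermediateField.fixedField (Subgroup.zpowers τ)}
    (hd : δ * δ = algebraMap (IntermediateField.fixedField (Subgroup.zpowers τ)) C d) (Z : ideleGroup C) :
    quadraticArtinIndicator (↥(IntermediateField.fixedField (Subgroup.zpowers τ))) d
        (AdeleRing.ideleRelNorm (↥(IntermediateField.fixedField (Subgroup.zpowers τ))) C Z) = 0 :=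
  (quadraticArtinIndicator_fixedField_eq_zero_iff τ hτ hτ1 hδ hδ0 hd _).2 ⟨1, Z, by simp⟩

/-- **`[(k) · N_{C/C^τ} Z]_{C^τ, d} = 0`**: a global unit times a norm has indicator `0` (the shape of ★ `HasseNormEtaleInvolutionDescent`'s
(E4)∕(E5) right-hand sides). [cite: CasselsFrohlichANT1967, Ch. VII §5.1 (B)] -/
theorem quadraticArtinIndicator_fixedField_principal_mul_ideleRelNorm [IsGalois (IntermediateField.fixedField (Subgroup.zpowers τ)) C]
    (hτ : τ * τ = 1) (hτ1 : τ ≠ 1) {δ : C} (hδ : τ δ = -δ) (hδ0 : δ ≠ 0) {d : IntermediateField.fixedField (Subgroup.zpowers τ)}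
    (hd : δ * δ = algebraMap (IntermediateField.fixedField (Subgroup.zpowers τ)) C d)
    (k : (↥(IntermediateField.fixedField (Subgroup.zpowers τ)))ˣ) (Z : ideleGroup C) :
    quadraticArtinIndicator (↥(IntermediateField.fixedField (Subgroup.zpowers τ))) d
        (IdeleHerbrand.principal (↥(IntermediateField.fixedField (Subgroup.zpowers τ))) k *
          AdeleRing.ideleRelNorm (↥(IntermediateField.fixedField (Subgroup.zpowers τ))) C Z) = 0 :=
  (quadraticArtinIndicator_fixedField_eq_zero_iff τ hτ hτ1 hδ hδ0 hd _).2 ⟨k, Z, rfl⟩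

/-- **The indicator is invariant under idelic norms from `C`**: `[X · N_{C/C^τ} Z]_{C^τ, d} = [X]_{C^τ, d}` (additivity ★
`quadraticArtinIndicator_mul` + `…_fixedField_ideleRelNorm`). [cite: CasselsFrohlichANT1967, Ch. VII §5.1 (B)] -/
theorem quadraticArtinIndicator_fixedField_mul_ideleRelNorm [IsGalois (IntermediateField.fixedField (Subgroup.zpowers τ)) C]
    (hτ : τ * τ = 1) (hτ1 : τ ≠ 1) {δ : C} (hδ : τ δ = -δ) (hδ0 : δ ≠ 0) {d : IntermediateField.fixedField (Subgroup.zpowers τ)}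
    (hd : δ * δ = algebraMap (IntermediateField.fixedField (Subgroup.zpowers τ)) C d)
    (X : ideleGroup (↥(IntermediateField.fixedField (Subgroup.zpowers τ)))) (Z : ideleGroup C) :
    quadraticArtinIndicator (↥(IntermediateField.fixedField (Subgroup.zpowers τ))) d
        (X * AdeleRing.ideleRelNorm (↥(IntermediateField.fixedField (Subgroup.zpowers τ))) C Z) =
      quadraticArtinIndicator (↥(IntermediateField.fixedField (Subgroup.zpowers τ))) d X := by
  rw [quadraticArtinIndicator_mul (ne_zero_of_mul_self_eq_algebraMap hδ0 hd),
    quadraticArtinIndicator_fixedField_ideleRelNorm τ hτ hτ1 hδ hδ0 hd, add_zero]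

/-- **The indicator is invariant under global units**: `[(k) · X]_{C^τ, d} = [X]_{C^τ, d}`. [cite: CasselsFrohlichANT1967, Ch. VII §5.1 (B)] -/
theorem quadraticArtinIndicator_fixedField_principal_mul {δ : C} (hδ0 : δ ≠ 0) {d : IntermediateField.fixedField (Subgroup.zpowers τ)}
    (hd : δ * δ = algebraMap (IntermediateField.fixedField (Subgroup.zpowers τ)) C d)
    (k : (↥(IntermediateField.fixedField (Subgroup.zpowers τ)))ˣ) (X : ideleGroup (↥(IntermediateField.fixedField (Subgroup.zpowers τ)))) :
    quadraticArtinIndicator (↥(IntermediateField.fixedField (Subgroup.zpowers τ))) d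
        (IdeleHerbrand.principal (↥(IntermediateField.fixedField (Subgroup.zpowers τ))) k * X) =
      quadraticArtinIndicator (↥(IntermediateField.fixedField (Subgroup.zpowers τ))) d X := by
  rw [quadraticArtinIndicator_mul (ne_zero_of_mul_self_eq_algebraMap hδ0 hd),
    quadraticArtinIndicator_of_mem_principalIdeles (by rw [principal_eq_unitsMap]; exact ⟨k, rfl⟩), zero_add]

end Indicator

/-! ## §4 (J5) The parameter in the base field `F`: `δ² = d ⊗ 1` with `d ∈ F` -/

section BaseParameter

open Literature.NumberTheory.Automorphic

variable {F C : Type} [Field F] [NumberField F] [Field C] [NumberField C] [Algebra F C] (τ : C ≃ₐ[F] C)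

/-- **(J2) with base parameter**: `N_{C/C^τ}(𝕀_C) = normIdeles (C^τ) (d ⊗ 1)` for `τ δ = −δ ≠ 0`, `δ² = d ⊗ 1`, `d ∈ F`.
[cite: Omeara1963, §65A Example 65:2] -/
theorem range_ideleRelNorm_fixedField_eq_normIdeles_algebraMap [IsGalois (IntermediateField.fixedField (Subgroup.zpowers τ)) C]
    (hτ : τ * τ = 1) (hτ1 : τ ≠ 1) {δ : C} (hδ : τ δ = -δ) (hδ0 : δ ≠ 0) {d : F} (hd : δ * δ = algebraMap F C d) :
    (AdeleRing.ideleRelNorm (↥(IntermediateField.fixedField (Subgroup.zpowers τ))) C).range =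
      normIdeles (↥(IntermediateField.fixedField (Subgroup.zpowers τ)))
        (algebraMap F (IntermediateField.fixedField (Subgroup.zpowers τ)) d) :=
  range_ideleRelNorm_fixedField_eq_normIdeles τ hτ hτ1 hδ hδ0 (mul_self_eq_algebraMap_fixedField τ hd)

/-- **(J3) with base parameter**: `(C^τ)ˣ · N_{C/C^τ}(𝕀_C) = (C^τ)ˣ · normIdeles (C^τ) (d ⊗ 1)`. [cite: CasselsFrohlichANT1967, Ch. VII §5.1 (B)] -/
theorem principalIdeles_sup_range_ideleRelNorm_fixedField_eq_algebraMap [IsGalois (IntermediateField.fixedField (Subgroup.zpowers τ)) C]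
    (hτ : τ * τ = 1) (hτ1 : τ ≠ 1) {δ : C} (hδ : τ δ = -δ) (hδ0 : δ ≠ 0) {d : F} (hd : δ * δ = algebraMap F C d) :
    principalIdeles (↥(IntermediateField.fixedField (Subgroup.zpowers τ))) ⊔
        (AdeleRing.ideleRelNorm (↥(IntermediateField.fixedField (Subgroup.zpowers τ))) C).range =
      principalIdeles (↥(IntermediateField.fixedField (Subgroup.zpowers τ))) ⊔
        normIdeles (↥(IntermediateField.fixedField (Subgroup.zpowers τ)))
          (algebraMap F (IntermediateField.fixedField (Subgroup.zpowers τ)) d) :=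
  principalIdeles_sup_range_ideleRelNorm_fixedField_eq τ hτ hτ1 hδ hδ0 (mul_self_eq_algebraMap_fixedField τ hd)

/-- **(J4) with base parameter**: `[X]_{C^τ, d ⊗ 1} = 0 ⟺ X = (k) · N_{C/C^τ}(Z)`. [cite: Omeara1963, §65A Example 65:2]
[cite: CasselsFrohlichANT1967, Ch. VII §5.1 (B)] -/
theorem quadraticArtinIndicator_fixedField_algebraMap_eq_zero_iff [IsGalois (IntermediateField.fixedField (Subgroup.zpowers τ)) C]
    (hτ : τ * τ = 1) (hτ1 : τ ≠ 1) {δ : C} (hδ : τ δ = -δ) (hδ0 : δ ≠ 0) {d : F} (hd : δ * δ = algebraMap F C d)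
    (X : ideleGroup (↥(IntermediateField.fixedField (Subgroup.zpowers τ)))) :
    quadraticArtinIndicator (↥(IntermediateField.fixedField (Subgroup.zpowers τ)))
        (algebraMap F (IntermediateField.fixedField (Subgroup.zpowers τ)) d) X = 0 ↔
      ∃ (k : (↥(IntermediateField.fixedField (Subgroup.zpowers τ)))ˣ) (Z : ideleGroup C),
        X = IdeleHerbrand.principal (↥(IntermediateField.fixedField (Subgroup.zpowers τ))) k *
          AdeleRing.ideleRelNorm (↥(IntermediateField.fixedField (Subgroup.zpowers τ))) C Z :=
  quadraticArtinIndicator_fixedField_eq_zero_iff τ hτ hτ1 hδ hδ0 (mul_self_eq_algebraMap_fixedField τ hd) X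

/-- **(J4) with base parameter, subgroup form**: `[X]_{C^τ, d ⊗ 1} = 0 ↔ X ∈ (C^τ)ˣ · N_{C/C^τ}(𝕀_C)`. [cite: CasselsFrohlichANT1967, Ch. VII §5.1 (B)] -/
theorem quadraticArtinIndicator_fixedField_algebraMap_eq_zero_iff_mem_sup [IsGalois (IntermediateField.fixedField (Subgroup.zpowers τ)) C]
    (hτ : τ * τ = 1) (hτ1 : τ ≠ 1) {δ : C} (hδ : τ δ = -δ) (hδ0 : δ ≠ 0) {d : F} (hd : δ * δ = algebraMap F C d)
    (X : ideleGroup (↥(IntermediateField.fixedField (Subgroup.zpowers τ)))) :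
    quadraticArtinIndicator (↥(IntermediateField.fixedField (Subgroup.zpowers τ)))
        (algebraMap F (IntermediateField.fixedField (Subgroup.zpowers τ)) d) X = 0 ↔
      X ∈ principalIdeles (↥(IntermediateField.fixedField (Subgroup.zpowers τ))) ⊔
        (AdeleRing.ideleRelNorm (↥(IntermediateField.fixedField (Subgroup.zpowers τ))) C).range :=
  quadraticArtinIndicator_fixedField_eq_zero_iff_mem_sup τ hτ hτ1 hδ hδ0 (mul_self_eq_algebraMap_fixedField τ hd) X

/-- **Norms have indicator `0`, base parameter**: `[N_{C/C^τ} Z]_{C^τ, d ⊗ 1} = 0`. [cite: Omeara1963, §65A Example 65:2] -/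
theorem quadraticArtinIndicator_fixedField_algebraMap_ideleRelNorm [IsGalois (IntermediateField.fixedField (Subgroup.zpowers τ)) C]
    (hτ : τ * τ = 1) (hτ1 : τ ≠ 1) {δ : C} (hδ : τ δ = -δ) (hδ0 : δ ≠ 0) {d : F} (hd : δ * δ = algebraMap F C d) (Z : ideleGroup C) :
    quadraticArtinIndicator (↥(IntermediateField.fixedField (Subgroup.zpowers τ)))
        (algebraMap F (IntermediateField.fixedField (Subgroup.zpowers τ)) d)
        (AdeleRing.ideleRelNorm (↥(IntermediateField.fixedField (Subgroup.zpowers τ))) C Z) = 0 :=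
  quadraticArtinIndicator_fixedField_ideleRelNorm τ hτ hτ1 hδ hδ0 (mul_self_eq_algebraMap_fixedField τ hd) Z

/-- **`[(k) · N Z]_{C^τ, d ⊗ 1} = 0`, base parameter.** [cite: CasselsFrohlichANT1967, Ch. VII §5.1 (B)] -/
theorem quadraticArtinIndicator_fixedField_algebraMap_principal_mul_ideleRelNorm
    [IsGalois (IntermediateField.fixedField (Subgroup.zpowers τ)) C]
    (hτ : τ * τ = 1) (hτ1 : τ ≠ 1) {δ : C} (hδ : τ δ = -δ) (hδ0 : δ ≠ 0) {d : F} (hd : δ * δ = algebraMap F C d)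
    (k : (↥(IntermediateField.fixedField (Subgroup.zpowers τ)))ˣ) (Z : ideleGroup C) :
    quadraticArtinIndicator (↥(IntermediateField.fixedField (Subgroup.zpowers τ)))
        (algebraMap F (IntermediateField.fixedField (Subgroup.zpowers τ)) d)
        (IdeleHerbrand.principal (↥(IntermediateField.fixedField (Subgroup.zpowers τ))) k *
          AdeleRing.ideleRelNorm (↥(IntermediateField.fixedField (Subgroup.zpowers τ))) C Z) = 0 :=
  quadraticArtinIndicator_fixedField_principal_mul_ideleRelNorm τ hτ hτ1 hδ hδ0 (mul_self_eq_algebraMap_fixedField τ hd) k Z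

/-- **Invariance under norms, base parameter**: `[X · N_{C/C^τ} Z]_{C^τ, d ⊗ 1} = [X]_{C^τ, d ⊗ 1}`. [cite: CasselsFrohlichANT1967, Ch. VII §5.1 (B)] -/
theorem quadraticArtinIndicator_fixedField_algebraMap_mul_ideleRelNorm [IsGalois (IntermediateField.fixedField (Subgroup.zpowers τ)) C]
    (hτ : τ * τ = 1) (hτ1 : τ ≠ 1) {δ : C} (hδ : τ δ = -δ) (hδ0 : δ ≠ 0) {d : F} (hd : δ * δ = algebraMap F C d)
    (X : ideleGroup (↥(IntermediateField.fixedField (Subgroup.zpowers τ)))) (Z : ideleGroup C) :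
    quadraticArtinIndicator (↥(IntermediateField.fixedField (Subgroup.zpowers τ)))
        (algebraMap F (IntermediateField.fixedField (Subgroup.zpowers τ)) d)
        (X * AdeleRing.ideleRelNorm (↥(IntermediateField.fixedField (Subgroup.zpowers τ))) C Z) =
      quadraticArtinIndicator (↥(IntermediateField.fixedField (Subgroup.zpowers τ)))
        (algebraMap F (IntermediateField.fixedField (Subgroup.zpowers τ)) d) X :=
  quadraticArtinIndicator_fixedField_mul_ideleRelNorm τ hτ hτ1 hδ hδ0 (mul_self_eq_algebraMap_fixedField τ hd) X Z

end BaseParameter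

end Literature.NumberTheory.GaloisRepresentations

end
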